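import Literature.NumberTheory.LFunctions.PolynomialRootMoebiusDirichlet
import Literature.NumberTheory.LFunctions.RieszMeanInvDedekindZeta
import Literature.NumberTheory.LFunctions.DegreeOnePrimes
import Literature.NumberTheory.Sieve.BatemanHornProofs
import HarnessLib

/-!
# Landau's theorem for `∑ μ(n)ρ_g(n)/n`: the logarithmic Riesz mean converges, with
# de la Vallée-Poussin error

Topic `Literature/NumberTheory/LFunctions` (consumer of `PolynomialRootMoebiusDirichlet.lean` and of the
tree's Landau–Riesz tool `NumberField.logRieszMean_LSeries_div_dedekindZeta_bound`).  Everything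
here is PROVED.

For `g ∈ ℤ[X]` irreducible of positive degree (any leading coefficient) and
`ρ_g(n) = #{r mod n : g(r) ≡ 0 (mod n)}`:

* `abs_logRieszMean_moebius_rootCount_sub_le` — there are `L ∈ ℝ`, `c > 0`, `C` with
  `|∑_{n ≤ x} μ(n)ρ_g(n)/n · log(x/n) − L| ≤ C·exp(−c√(log x))` for all `x ≥ 1`;
* `exists_tendsto_logRieszMean_moebius_rootCount` — hence `∑_{n ≤ x} μ(n)ρ_g(n)/n · log(x/n) → L`.

This is the prime ideal theorem for `K = ℚ[X]/(g)` in "M-function, first-order Riesz mean"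
form (`L = H(1)/res_{s=1}ζ_K`): the Dirichlet series of `μρ_g` is `H(s)/ζ_K(s)` with `H`
absolutely convergent on `Re s > 1/2`, because `c_K(p) = ρ_g(p)` for all but finitely many `p`
(Dedekind–Kummer, `DegreeOnePrimes.exists_card_absNorm_eq_prime_eq_rootCount`, applied to the
monic integral normalisation `g₁` of `g`, `ρ_{g₁}(p) = ρ_g(p)` for `p ∤ lc g`,
`polyRootCountMod_integralNormalization`).  For `g = X` it is `∑_{n ≤ x} μ(n)/n · log(x/n) → 1`
(Montgomery–Vaughan §6.2 / (8.7) of Heath-Brown with `K = ℚ`).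

## References
* E. Landau, Math. Ann. 56 (1903), 645–670, Part II (prime ideal theorem with error term; the
  analytic input, PROVED in the tree). [LandauMathAnn1903]
* D. R. Heath-Brown, Acta Math. 186 (2001), §8 p. 51 (the Riesz-mean evaluation `Σ`). [HeathBrownActa2001]
* H. L. Montgomery, R. C. Vaughan, *Multiplicative Number Theory I*, §6.2. [MontgomeryVaughan2007]
-/

noncomputable section

open Filter Finset Nat ArithmeticFunction Polynomial Complex
open scoped Topology BigOperators NumberField ArithmeticFunction.Moebius

namespace Literature.NumberTheory.LFunctions

open Literature.NumberTheory.Sieve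

/-- `a = μρ_g` as a complex arithmetic function (same local notation as in
`PolynomialRootMoebiusDirichlet.lean`). -/
local notation "μρ[" g "]" => toArithmeticFunction (fun n : ℕ =>
  ((ArithmeticFunction.moebius n : ℤ) : ℂ) * ((Literature.NumberTheory.Sieve.polyRootCountMod ![g] n : ℕ) : ℂ))

/-- `c_K` as a complex arithmetic function (zeroed at `0`). -/
local notation "cK[" K "]" => toArithmeticFunction (fun n : ℕ =>
  ((Literature.NumberTheory.LFunctions.idealNormCount K n : ℕ) : ℂ))

/-- `h = a ⋆ c_K`. -/
local notation "hE[" g ", " K "]" => ((μρ[g]) * (cK[K]) : ArithmeticFunction ℂ)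

variable (K : Type*) [Field K] [NumberField K]

/-! ## The tool's hypotheses for `a = μρ_g`, `h = a ⋆ c_K` -/

/-- `LSeries c_K = ζ_K` (the coefficient sequences agree off `0`). [folklore] -/
theorem LSeries_idealCountFunction (s : ℂ) :
    LSeries (cK[K]) s = NumberField.dedekindZeta K s := by
  rw [dedekindZeta_eq_LSeries]
  exact LSeries_congr (fun hn => idealCountFunction_apply K hn) s

section Instantiate

variable {g : ℤ[X]} (hirr : Irreducible g) (hdeg : 0 < g.natDegree)
include hirr hdeg

/-- `‖a(p^j)‖ ≤ deg g` for `j ≥ 1` (it is `ρ_g(p) ≤ deg g` at `j = 1`, `0` beyond). [folklore] -/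
theorem norm_moebiusRootCount_prime_pow_le {p : ℕ} (hp : p.Prime) {j : ℕ} (hj : 1 ≤ j) :
    ‖μρ[g] (p ^ j)‖ ≤ (g.natDegree : ℝ) * ((j : ℝ) + 1) ^ 0 := by
  rw [pow_zero, mul_one]
  rcases eq_or_lt_of_le hj with rfl | hj2
  · rw [pow_one, moebiusRootCount_prime g hp, norm_neg, Complex.norm_natCast]
    exact_mod_cast polyRootCountMod_prime_le_natDegree_of_irreducible hirr hdeg hp
  · rw [moebiusRootCount_prime_pow g hp hj2, norm_zero]
    positivity

/-- `LSeriesSummable a σ` for `σ > 1`. [folklore] -/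
theorem lseriesSummable_moebiusRootCount {σ : ℝ} (hσ : 1 < σ) :
    LSeriesSummable (μρ[g]) σ := by
  have hprimes : Summable fun p : Nat.Primes => ‖μρ[g] p‖ * (p : ℝ) ^ (-σ) := by
    have h1 : Summable fun p : Nat.Primes => (g.natDegree : ℝ) * ((p : ℕ) : ℝ) ^ (-σ) :=
      ((Nat.Primes.summable_rpow).mpr (by linarith)).mul_left _
    refine h1.of_nonneg_of_le (fun p => by positivity) fun p => ?_
    refine mul_le_mul_of_nonneg_right ?_ (by positivity)
    have := norm_moebiusRootCount_prime_pow_le hirr hdeg p.prop (j := 1) le_rfl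
    simpa using this
  obtain ⟨B, hs, -⟩ := lseriesSummable_of_isMultiplicative_of_prime_pow_le
    (isMultiplicative_moebiusRootCount g) (Nat.cast_nonneg _) (N := 0)
    (by linarith : (1 : ℝ) / 2 < σ)
    (fun p hp j hj => norm_moebiusRootCount_prime_pow_le hirr hdeg hp hj) hprimes
  exact hs

/-- `‖h(p^j)‖ ≤ (deg g + 1)(j+1)^{[K:ℚ]}` for `j ≥ 1`. [folklore] -/
theorem norm_rootExcess_prime_pow_le' {p : ℕ} (hp : p.Prime) {j : ℕ} (hj : 1 ≤ j) :
    ‖hE[g, K] (p ^ j)‖ ≤ ((g.natDegree : ℝ) + 1) * ((j : ℝ) + 1) ^ Module.finrank ℚ K := by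
  have h := norm_rootExcess_prime_pow_le g K hp hj
  have hc1 := idealNormCount_prime_pow_le K p j hp
  have hc2 := idealNormCount_prime_pow_le K p (j - 1) hp
  have hρ : (polyRootCountMod ![g] p : ℝ) ≤ g.natDegree := by
    exact_mod_cast polyRootCountMod_prime_le_natDegree_of_irreducible hirr hdeg hp
  have hj1 : (((j - 1 : ℕ) : ℝ) + 1) ^ Module.finrank ℚ K ≤ ((j : ℝ) + 1) ^ Module.finrank ℚ K := by
    apply pow_le_pow_left₀ (by positivity)
    have : ((j - 1 : ℕ) : ℝ) ≤ j := by exact_mod_cast Nat.sub_le j 1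
    linarith
  calc ‖hE[g, K] (p ^ j)‖
      ≤ (idealNormCount K (p ^ j) : ℝ) +
          (polyRootCountMod ![g] p : ℝ) * (idealNormCount K (p ^ (j - 1)) : ℝ) := h
    _ ≤ ((j : ℝ) + 1) ^ Module.finrank ℚ K +
          (g.natDegree : ℝ) * ((j : ℝ) + 1) ^ Module.finrank ℚ K := by
        gcongr
        · exact hc2.trans hj1
    _ = ((g.natDegree : ℝ) + 1) * ((j : ℝ) + 1) ^ Module.finrank ℚ K := by ring

/-- The convolution identity `LSeries a · ζ_K = LSeries (a ⋆ c_K)` on `Re s > 1`. [folklore] -/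
theorem LSeries_moebiusRootCount_mul_dedekindZeta {s : ℂ} (hs : 1 < s.re) :
    LSeries (μρ[g]) s * NumberField.dedekindZeta K s =
      LSeries (hE[g, K]) s := by
  have ha : LSeriesSummable (μρ[g]) s :=
    (LSeriesSummable_iff_of_re_eq_re (by simp)).mp (lseriesSummable_moebiusRootCount hirr hdeg hs)
  have hc : LSeriesSummable (cK[K]) s :=
    (LSeriesSummable_congr s (fun hn => idealCountFunction_apply K hn)).mpr
      (LSeriesSummable_dedekindZeta (K := K) hs)
  rw [← LSeries_idealCountFunction K s, ← LSeries_convolution' ha hc]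
  congr 1
  simp only [LSeries.convolution, ArithmeticFunction.toArithmeticFunction_eq_self]

/-- **`h = a ⋆ c_K` is `LSeriesSummable` at `3/4`** whenever `c_K(p) = ρ_g(p)` off a finite set of
primes (then `h(p) = 0` there, and `‖h(p^j)‖ ≤ (deg g + 1)(j+1)^{[K:ℚ]}`). [folklore] -/
theorem lseriesSummable_rootExcess
    (hgood : ∃ e : ℕ, 0 < e ∧ ∀ p : ℕ, p.Prime → ¬ p ∣ e → hE[g, K] p = 0) :
    ∃ B : ℝ, LSeriesSummable (hE[g, K]) ((3 / 4 : ℝ) : ℂ) ∧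
      ∑' n, ‖LSeries.term (hE[g, K]) ((3 / 4 : ℝ) : ℂ) n‖ ≤ B := by
  obtain ⟨e, he, hgood⟩ := hgood
  have hprimes : Summable fun p : Nat.Primes => ‖hE[g, K] p‖ * (p : ℝ) ^ (-(3 / 4 : ℝ)) := by
    refine summable_of_ne_finset_zero (s := (e.primeFactors).subtype Nat.Prime) fun p hp => ?_
    have hpe : ¬ (p : ℕ) ∣ e := fun hdvd =>
      hp (Finset.mem_subtype.mpr (Nat.mem_primeFactors.mpr ⟨p.prop, hdvd, he.ne'⟩))
    rw [hgood p p.prop hpe, norm_zero, zero_mul]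
  exact lseriesSummable_of_isMultiplicative_of_prime_pow_le (isMultiplicative_rootExcess g K)
    (by positivity : (0 : ℝ) ≤ (g.natDegree : ℝ) + 1) (N := Module.finrank ℚ K)
    (by norm_num : (1 : ℝ) / 2 < 3 / 4)
    (fun p hp j hj => norm_rootExcess_prime_pow_le' K hirr hdeg hp hj) hprimes

/-- The log-Riesz mean of `a = μρ_g` converges with de la Vallée-Poussin rate, given a number
field `K` whose degree-one prime counts match `ρ_g` off finitely many primes
(`NumberField.logRieszMean_LSeries_div_dedekindZeta_bound`). [cite: LandauMathAnn1903, Part II] -/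
theorem logRieszMean_moebiusRootCount_bound_of_good
    (hgood : ∃ e : ℕ, 0 < e ∧ ∀ p : ℕ, p.Prime → ¬ p ∣ e → hE[g, K] p = 0) :
    ∃ L : ℂ, ∃ c : ℝ, 0 < c ∧ ∃ C : ℝ, ∀ x : ℝ, 1 ≤ x →
      ‖(∑ n ∈ Finset.Icc 1 ⌊x⌋₊, μρ[g] n / n * (Real.log (x / n) : ℂ)) - L‖ ≤
        C * Real.exp (-c * Real.sqrt (Real.log x)) := by
  obtain ⟨c, hc, C, hC, htool⟩ :=
    NumberField.logRieszMean_LSeries_div_dedekindZeta_bound K (σₕ := 3 / 4) (by norm_num)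
  obtain ⟨B, hhs, hhB⟩ := lseriesSummable_rootExcess K hirr hdeg hgood
  refine ⟨LSeries (hE[g, K]) 1 / (NumberField.dedekindZeta_residue K : ℂ),
    c, hc, C * B, fun x hx => ?_⟩
  exact htool (μρ[g]) (hE[g, K]) B hhs hhB
    (fun σ hσ => lseriesSummable_moebiusRootCount hirr hdeg hσ)
    (fun s hs => LSeries_moebiusRootCount_mul_dedekindZeta K hirr hdeg hs) x hx

end Instantiate

/-! ## The matching number field `ℚ[X]/(g₁)` and the real statements -/

/-- `ρ_g(p)` in the `polyRootCountMod ![g]` form equals the single-polynomial count. [folklore] -/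
theorem polyRootCountMod_single_eq_card (g : ℤ[X]) (p : ℕ) :
    polyRootCountMod ![g] p = #((range p).filter fun n : ℕ => (p : ℤ) ∣ g.eval (n : ℤ)) := by
  unfold polyRootCountMod
  simp

/-- **Good primes**: for `g` irreducible of positive degree, `g₁` its (monic, irreducible)
integral normalisation and `K = ℚ[X]/(g₁)`: `c_K(p) = ρ_{g₁}(p) = ρ_g(p)`, i.e. `(a ⋆ c_K)(p) = 0`,
for all primes `p ∤ e·lc(g)`. [folklore] -/
theorem exists_rootExcess_prime_eq_zero {g : ℤ[X]} (hirr : Irreducible g) (hdeg : 0 < g.natDegree)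
    [Fact (Irreducible ((integralNormalization g).map (algebraMap ℤ ℚ)))] :
    ∃ e : ℕ, 0 < e ∧ ∀ p : ℕ, p.Prime → ¬ p ∣ e →
      hE[g, AdjoinRoot ((integralNormalization g).map (algebraMap ℤ ℚ))] p = 0 := by
  have hmon : (integralNormalization g).Monic := monic_integralNormalization hirr.ne_zero
  have hirr₁ : Irreducible (integralNormalization g) := irreducible_integralNormalization hirr hdeg
  obtain ⟨e, he, H⟩ := DegreeOnePrimes.exists_card_absNorm_eq_prime_eq_rootCount hmon hirr₁
  have hlc : g.leadingCoeff ≠ 0 := leadingCoeff_ne_zero.mpr hirr.ne_zero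
  refine ⟨e * g.leadingCoeff.natAbs, Nat.mul_pos he (Int.natAbs_pos.mpr hlc), fun p hp hpe => ?_⟩
  have hpe₁ : ¬ p ∣ e := fun h => hpe (Dvd.dvd.mul_right h _)
  have hplc : ¬ (p : ℤ) ∣ g.leadingCoeff := fun h =>
    hpe (Dvd.dvd.mul_left (Int.natCast_dvd.mp h) _)
  rw [rootExcess_prime g _ hp, idealNormCount, H p hp hpe₁, ← polyRootCountMod_single_eq_card,
    polyRootCountMod_integralNormalization hdeg hp hplc, sub_self]

/-- The complex Riesz sum is the real one. [folklore] -/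
theorem logRieszSum_moebiusRootCount_eq_ofReal (g : ℤ[X]) (x : ℝ) :
    (∑ n ∈ Finset.Icc 1 ⌊x⌋₊, μρ[g] n / n * (Real.log (x / n) : ℂ)) =
      ((∑ n ∈ Finset.Icc 1 ⌊x⌋₊, (ArithmeticFunction.moebius n : ℝ) *
        (polyRootCountMod ![g] n : ℝ) / n * Real.log (x / n) : ℝ) : ℂ) := by
  push_cast
  refine Finset.sum_congr rfl fun n _ => ?_
  rw [moebiusRootCount_apply]

/-- **Landau's theorem for `∑ μ(n)ρ_g(n)/n`, log-Riesz form with de la Vallée-Poussin error.**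
For `g ∈ ℤ[X]` irreducible of positive degree there are `L`, `c > 0`, `C` with
`|∑_{n ≤ x} μ(n)ρ_g(n)/n · log(x/n) − L| ≤ C exp(−c√log x)` for all `x ≥ 1`.
[cite: LandauMathAnn1903, Part II] -/
theorem abs_logRieszMean_moebius_rootCount_sub_le {g : ℤ[X]} (hirr : Irreducible g)
    (hdeg : 0 < g.natDegree) :
    ∃ L : ℝ, ∃ c : ℝ, 0 < c ∧ ∃ C : ℝ, ∀ x : ℝ, 1 ≤ x →
      |(∑ n ∈ Finset.Icc 1 ⌊x⌋₊, (ArithmeticFunction.moebius n : ℝ) *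
          (polyRootCountMod ![g] n : ℝ) / n * Real.log (x / n)) - L| ≤
        C * Real.exp (-c * Real.sqrt (Real.log x)) := by
  haveI : Fact (Irreducible ((integralNormalization g).map (algebraMap ℤ ℚ))) :=
    ⟨DegreeOnePrimes.irreducible_map_rat (monic_integralNormalization hirr.ne_zero)
      (irreducible_integralNormalization hirr hdeg)⟩
  obtain ⟨L, c, hc, C, H⟩ := logRieszMean_moebiusRootCount_bound_of_good
    (AdjoinRoot ((integralNormalization g).map (algebraMap ℤ ℚ))) hirr hdeg
    (exists_rootExcess_prime_eq_zero hirr hdeg)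
  refine ⟨L.re, c, hc, C, fun x hx => ?_⟩
  have h := H x hx
  rw [logRieszSum_moebiusRootCount_eq_ofReal] at h
  calc |(∑ n ∈ Finset.Icc 1 ⌊x⌋₊, (ArithmeticFunction.moebius n : ℝ) *
          (polyRootCountMod ![g] n : ℝ) / n * Real.log (x / n)) - L.re|
      = |(((∑ n ∈ Finset.Icc 1 ⌊x⌋₊, (ArithmeticFunction.moebius n : ℝ) *
          (polyRootCountMod ![g] n : ℝ) / n * Real.log (x / n) : ℝ) : ℂ) - L).re| := by simp
    _ ≤ ‖((∑ n ∈ Finset.Icc 1 ⌊x⌋₊, (ArithmeticFunction.moebius n : ℝ) *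
          (polyRootCountMod ![g] n : ℝ) / n * Real.log (x / n) : ℝ) : ℂ) - L‖ :=
        Complex.abs_re_le_norm _
    _ ≤ C * Real.exp (-c * Real.sqrt (Real.log x)) := h

/-- **Convergence of the log-Riesz mean `∑_{n ≤ x} μ(n)ρ_g(n)/n · log(x/n)`** (real `x → ∞`).
[cite: LandauMathAnn1903, Part II] -/
theorem exists_tendsto_logRieszMean_moebius_rootCount {g : ℤ[X]} (hirr : Irreducible g)
    (hdeg : 0 < g.natDegree) :
    ∃ L : ℝ, Tendsto (fun x : ℝ => ∑ n ∈ Finset.Icc 1 ⌊x⌋₊,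
      (ArithmeticFunction.moebius n : ℝ) * (polyRootCountMod ![g] n : ℝ) / n * Real.log (x / n))
      atTop (𝓝 L) := by
  obtain ⟨L, c, hc, C, H⟩ := abs_logRieszMean_moebius_rootCount_sub_le hirr hdeg
  refine ⟨L, ?_⟩
  have hE : Tendsto (fun x : ℝ => C * Real.exp (-c * Real.sqrt (Real.log x))) atTop (𝓝 0) := by
    have h1 : Tendsto (fun x : ℝ => -c * Real.sqrt (Real.log x)) atTop atBot := by
      have := (Real.tendsto_sqrt_atTop.comp Real.tendsto_log_atTop).const_mul_atTop_of_neg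
        (neg_lt_zero.mpr hc)
      simpa using this
    simpa using (Real.tendsto_exp_atBot.comp h1).const_mul C
  rw [Metric.tendsto_nhds]
  intro ε hε
  filter_upwards [(Metric.tendsto_nhds.mp hE) ε hε, eventually_ge_atTop (1 : ℝ)] with x hx hx1
  rw [Real.dist_eq]
  refine lt_of_le_of_lt (H x hx1) ?_
  rw [Real.dist_eq, sub_zero] at hx
  exact lt_of_abs_lt hx

/-- The same along the natural numbers `D → ∞` (`⌊D⌋₊ = D`). [cite: LandauMathAnn1903, Part II] -/
theorem exists_tendsto_logRieszMean_moebius_rootCount_nat {g : ℤ[X]} (hirr : Irreducible g)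
    (hdeg : 0 < g.natDegree) :
    ∃ L : ℝ, Tendsto (fun D : ℕ => ∑ n ∈ Finset.Icc 1 D,
      (ArithmeticFunction.moebius n : ℝ) * (polyRootCountMod ![g] n : ℝ) / n *
        Real.log ((D : ℝ) / n)) atTop (𝓝 L) := by
  obtain ⟨L, hL⟩ := exists_tendsto_logRieszMean_moebius_rootCount hirr hdeg
  refine ⟨L, ?_⟩
  have h := hL.comp tendsto_natCast_atTop_atTop
  refine h.congr fun D => ?_
  simp only [Function.comp_apply, Nat.floor_natCast]

end Literature.NumberTheory.LFunctions
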